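import Literature.NumberTheory.Automorphic.ArchEndoscopicChartMeasures      -- ★ p849670 LH2-p04 (g3) (T-MEAS) H-side: `chartBox` (the SAME coordinate box is reused here), pattern of `chartTorusH ∕ chartHaarH ∕ chartOrbH`
import Literature.NumberTheory.Automorphic.ArchInnerFormCartanAtlasCentralizer  -- ★ p849697 LH3-p03 (g2) (CENT-G): `mem_centralizer_gprimeTorus_iff` (+ PART 2b `gprimeTorus`, `_add ∕ _zero ∕ _comm`, `continuous_gprimeTorus`)
import HarnessLib

/-!
# The chart tori of `G′_∞ = U(diag α)(L⁺ ⊗ ℝ)`, their Haar measures, and the chart orbital functionals `chartOrbG` — the `G′`-side twin of ★ (T-MEAS)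
# (Rogawski 1990 §3.6, §4.9, §8.2–8.3; Shelstad 1979 §4; Deitmar–Echterhoff 2014 Thm. 1.5.3; Folland 1995 §2.6)

Topic `NumberTheory/Automorphic`; namespace `Literature.NumberTheory.Automorphic.UnitaryGroup`.  DEFINITIONS WITH BODIES (`gprimeTorusHom`, `chartTorusG`, `chartBoxImgG`,
`chartHaarG`, `chartQuotientMeasureG`, `chartOrbG`) + theorems; no instance, no notation, no axiom, no named fact, no `sorry`.  Cell `pub/hodgecm-mathlib`, crux H413
(`stmt-HodgeConjecture-24833`), F0∕P3c line LH3 (closer stub `stub_N9`, DIRECT ROAD); the `G′`-side half of organ «(T-MEAS)» of LH3-plan (g2)'s PACK-SPEC v1 §1 «CURRENCY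
DECISION» (2026-09-02T05:41:42Z; rulings D1∕D3∕(δ3)), written by LH3-p02 (g2) as the TOKEN-FOR-TOKEN MIRROR of ★ `ArchEndoscopicChartMeasures` (LH2-p04 (g3)) over the
`G′`-atlas ★ `gprimeTorus L α S′` (LH3-p03 (g2), `ArchInnerFormCartanAtlas`).  Imported by the D2′-pack (`orbFamG ν′ a′ S′ c := archRG S′ c · chartOrbG ν′ S′ a′ c`, LH3-p02)
and the (CUR) junction; count-neutral.

* §1 **`gprimeTorusHom α S′ : Multiplicative (W → Fin 3 → ℝ) →* G′_∞`** — the chart ★ `gprimeTorus` as a homomorphism (★ `gprimeTorus_add ∕ _zero`).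
* §2 **`chartTorusG α S′ : Subgroup G′_∞`** := the topological closure of its range (D1: the range IS closed and `= Z(gprimeTorus α S′ c)` at `c ∈ RegG S′` — ★ (CENT-G)
  `mem_centralizer_gprimeTorus_iff`; the closure only makes `IsClosed`, the hypothesis of ★ `quotientMeasure`, definitional): `isClosed_chartTorusG`, `gprimeTorus_mem_chartTorusG`,
  **`chartTorusG_le_centralizer`** (EVERY `c`), **`forall_mem_chartTorusG_comm`** (the ★ `descConj` binder), `chartTorusG_mul_comm`, `locallyCompactSpace_chartTorusG`,
  `continuous_descConj_gprimeTorus`, and **`chartTorusG_eq_centralizer`** (at `c ∈ RegG S′`, split places inside `splitChartPlaces`, `α i ≠ 0`: `T_{S′} = Z(gprimeTorus α S′ c)` —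
  the junction's «`Z(γ′)` at a chart point is the chart torus, uniformly in `c`»); the box image `chartBoxImgG α S′ = B′_{S′} ⊆ T_{S′}` of the SAME closed coordinate box ★
  `chartBox L S′` (`x ∈ [0,1]` in the split slot, angles `∈ [0, 2π]`; compact, `1 ∈ B′`).
* §3 **`chartHaarG α S′`** := an AUXILIARY Haar measure on `T_{S′}` (Mathlib `haarMeasure`): `isHaarMeasure_`, `regular_`, `isMulLeftInvariant_`, `isFiniteMeasureOnCompacts_`,
  `isOpenPosMeasure_`, **`isInvInvariant_chartHaarG`** (abelian), `chartHaarG_chartBoxImgG_lt_top`.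
* §4 **`chartQuotientMeasureG ν′ S′`** := ★ `quotientMeasure (chartTorusG α S′) (chartHaarG α S′) _ ν′` on `G′_∞ ⧸ T_{S′}` (Borel σ-algebra fixed INSIDE, D3) and
  **`chartOrbG ν′ S′ a′ c := dt′(B′) · ∫ y, a′ (y · gprimeTorus α S′ c · y⁻¹) d(dν′ ∕ dt′)(ȳ)`** (★ `descConj`; (δ3): the box-mass prefactor makes the functional INDEPENDENT of the
  auxiliary Haar measure), at EVERY `c`; `chartOrbG_def` (rfl), `chartOrbG_congr`, `chartOrbG_zero`.  Binders: `G′_∞`'s σ-algebra and `ν′`'s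
  `IsFiniteMeasureOnCompacts ∕ IsMulRightInvariant` only, so `orbFamG ν′ a′ S′ c := archRG S′ c · chartOrbG ν′ S′ a′ c` is a plain function of `c`.
NOT HERE: Haar-freeness `chartOrbG_eq_of_isHaarMeasure` and `0 < dt′(B′)` (same road as LH2-p04's sibling THEOREMS file for `H`); `orbFamG` and the (CUR) junction
«`classOrbitalIntegral m′ a′ ⟦gprimeTorus α S′ c⟧ · (t′ _)(B′) = chartOrbG ν′ S′ a′ c`» (LH3-p02, next file); the correspondence `B ↔ B′` under `e ∘ ι` ((PARTNER)).
HONEST LABEL: HC_CM is proved only modulo the 7 printed citations (2 remaining: hLiu418 = `stmt-HodgeConjecture-24832`, h413 = `stmt-HodgeConjecture-24833`) until rung 0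
closes; chart∕measure bookkeeping, moves no row of the books.

## References
* [Rogawski1990] J. D. Rogawski, *Automorphic Representations of Unitary Groups in Three Variables*, Ann. of Math. Stud. 123 (1990), §3.6 p. 31, §4.9 p. 54, §8.2–8.3 pp. 122–124.
* [Shelstad1979] D. Shelstad, *Characters and inner forms of a quasi-split group over ℝ*, Compositio Math. 39 (1979), §4 pp. 22–23 (`T`, `dt`, `Φ^T_f`).
* [DeitmarEchterhoff2014] A. Deitmar, S. Echterhoff, *Principles of Harmonic Analysis*, 2nd ed. (2014), Thm. 1.5.3 (quotient integral formula).
* [Folland1995] G. B. Folland, *A Course in Abstract Harmonic Analysis* (1995), §2.2 (Haar measure), §2.6 Thm. 2.49, (2.52).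
-/

set_option autoImplicit false

noncomputable section

open MeasureTheory MeasureTheory.Measure NumberField NumberField.InfinitePlace Matrix Complex Topology
open Literature.MeasureTheory.Group
open scoped MatrixGroups Matrix Classical

namespace Literature.NumberTheory.Automorphic.UnitaryGroup

/-! ## §1 The `G′`-chart as a homomorphism -/

section Hom

variable (L : Type) [Field L] [NumberField L] [IsCMField L] (α : Fin 3 → L)

/-- **The `G′`-chart as a monoid homomorphism** `Multiplicative (W → Fin 3 → ℝ) →* G′_∞` (★ `gprimeTorus_add ∕ _zero`). [cite: Rogawski1990, §3.6 p. 31] [cite: Shelstad1979, §4 p. 22] -/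
def gprimeTorusHom (S' : Finset {w : InfinitePlace L // IsComplex w}) : Multiplicative ({w : InfinitePlace L // IsComplex w} → Fin 3 → ℝ) →* ↥(arch (↥(maximalRealSubfield L)) L (IsCMField.complexConj L) 3 (Matrix.diagonal α)) where
  toFun c := gprimeTorus L α S' (Multiplicative.toAdd c)
  map_one' := gprimeTorus_zero L α S'
  map_mul' a b := gprimeTorus_add L α S' (Multiplicative.toAdd a) (Multiplicative.toAdd b)

/-- `gprimeTorusHom α S′ (ofAdd c) = gprimeTorus α S′ c` (definitional). [cite: Rogawski1990, §3.6 p. 31] -/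
@[simp] theorem gprimeTorusHom_apply (S' : Finset {w : InfinitePlace L // IsComplex w}) (c : Multiplicative ({w : InfinitePlace L // IsComplex w} → Fin 3 → ℝ)) :
    gprimeTorusHom L α S' c = gprimeTorus L α S' (Multiplicative.toAdd c) := rfl

end Hom

/-! ## §2 The chart torus `T_{S′} ≤ G′_∞` -/

section Torus

variable (L : Type) [Field L] [NumberField L] [IsCMField L] (α : Fin 3 → L) (S' : Finset {w : InfinitePlace L // IsComplex w})

/-- **The chart torus `T_{S′} ≤ G′_∞` of the Cartan class `S′`** — the (closure of the) image of the chart `c ↦ gprimeTorus α S′ c`: the fundamental noncompact Cartan at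
`w ∈ S′`, the compact diagonal one at `w ∉ S′`.  (The image is closed — `= Z(gprimeTorus α S′ c)` at regular `c`, `chartTorusG_eq_centralizer` — so this IS the image; the closure
only makes `IsClosed` definitionally available.) [cite: Rogawski1990, §3.6 p. 31; §8.2 p. 122] [cite: Shelstad1979, §4 p. 22] -/
def chartTorusG : Subgroup ↥(arch (↥(maximalRealSubfield L)) L (IsCMField.complexConj L) 3 (Matrix.diagonal α)) :=
  (gprimeTorusHom L α S').range.topologicalClosure

/-- `T_{S′}` is closed. [cite: Shelstad1979, §4 p. 22] -/
theorem isClosed_chartTorusG : IsClosed (chartTorusG L α S' : Set ↥(arch (↥(maximalRealSubfield L)) L (IsCMField.complexConj L) 3 (Matrix.diagonal α))) :=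
  Subgroup.isClosed_topologicalClosure _

/-- The range of the chart lies in `T_{S′}`. [cite: Rogawski1990, §3.6 p. 31] -/
theorem range_gprimeTorusHom_le_chartTorusG : (gprimeTorusHom L α S').range ≤ chartTorusG L α S' :=
  Subgroup.le_topologicalClosure _

/-- **Every chart point lies in `T_{S′}`.** [cite: Rogawski1990, §3.6 p. 31; §8.2 p. 122] -/
theorem gprimeTorus_mem_chartTorusG (c : {w : InfinitePlace L // IsComplex w} → Fin 3 → ℝ) : gprimeTorus L α S' c ∈ chartTorusG L α S' :=
  range_gprimeTorusHom_le_chartTorusG L α S' ⟨Multiplicative.ofAdd c, rfl⟩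

/-- The centraliser of a point is closed (the equation `h t = t h`). [folklore] -/
private theorem isClosed_centralizer_singleton'' {G : Type*} [Group G] [TopologicalSpace G] [IsTopologicalGroup G] [T2Space G] (t : G) :
    IsClosed (Subgroup.centralizer ({t} : Set G) : Set G) := by
  have h : (Subgroup.centralizer ({t} : Set G) : Set G) = {g : G | t * g = g * t} := by
    ext g
    simp [Subgroup.mem_centralizer_iff]
  rw [h]
  exact isClosed_eq (continuous_const.mul continuous_id) (continuous_id.mul continuous_const)

/-- **`T_{S′} ≤ Z(gprimeTorus α S′ c)` for EVERY `c`**: the range commutes with each chart point (★ `gprimeTorus_comm`) and centralisers are closed.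
[cite: Rogawski1990, §3.6 p. 31] [cite: Shelstad1979, §4 p. 22] -/
theorem chartTorusG_le_centralizer (c : {w : InfinitePlace L // IsComplex w} → Fin 3 → ℝ) :
    chartTorusG L α S' ≤ Subgroup.centralizer ({gprimeTorus L α S' c} : Set ↥(arch (↥(maximalRealSubfield L)) L (IsCMField.complexConj L) 3 (Matrix.diagonal α))) := by
  refine Subgroup.topologicalClosure_minimal _ ?_ (isClosed_centralizer_singleton'' _)
  rintro _ ⟨a, rfl⟩
  rw [Subgroup.mem_centralizer_iff]
  rintro _ rfl
  rw [gprimeTorusHom_apply]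
  exact gprimeTorus_comm L α S' c _

/-- **Every element of `T_{S′}` commutes with every chart point** — the well-definedness binder of ★ `descConj (gprimeTorus α S′ c) T_{S′} _`, for ALL `c`.
[cite: Rogawski1990, §8.2 p. 122] [cite: Shelstad1979, §4 p. 22] -/
theorem forall_mem_chartTorusG_comm (c : {w : InfinitePlace L // IsComplex w} → Fin 3 → ℝ) :
    ∀ m ∈ chartTorusG L α S', m * gprimeTorus L α S' c = gprimeTorus L α S' c * m := fun _ hm =>
  ((Subgroup.mem_centralizer_iff.mp (chartTorusG_le_centralizer L α S' c hm)) _ rfl).symm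

/-- The range of the chart is commutative. [cite: Rogawski1990, §3.6 p. 31] -/
theorem range_gprimeTorusHom_mul_comm (a b : ↥(gprimeTorusHom L α S').range) : a * b = b * a := by
  obtain ⟨a, x, rfl⟩ := a
  obtain ⟨b, y, rfl⟩ := b
  apply Subtype.ext
  simp only [Subgroup.coe_mul, gprimeTorusHom_apply]
  exact gprimeTorus_comm L α S' _ _

/-- **`T_{S′}` is abelian.** [cite: Rogawski1990, §3.6 p. 31] [cite: Shelstad1979, §4 p. 22] -/
theorem chartTorusG_mul_comm (a b : ↥(chartTorusG L α S')) : a * b = b * a :=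
  (Subgroup.commGroupTopologicalClosure (gprimeTorusHom L α S').range (range_gprimeTorusHom_mul_comm L α S')).mul_comm a b

/-- `T_{S′}` is locally compact (closed in the locally compact `G′_∞`). [cite: Folland1995, §2.2] -/
theorem locallyCompactSpace_chartTorusG : LocallyCompactSpace ↥(chartTorusG L α S') :=
  (isClosed_chartTorusG L α S').isClosedEmbedding_subtypeVal.locallyCompactSpace

/-- The chart orbital integrand `y T_{S′} ↦ a′ (y · gprimeTorus α S′ c · y⁻¹)` is continuous for continuous `a′`. [cite: Rogawski1990, §8.3 p. 124] -/
theorem continuous_descConj_gprimeTorus {Y : Type*} [TopologicalSpace Y] (a' : ↥(arch (↥(maximalRealSubfield L)) L (IsCMField.complexConj L) 3 (Matrix.diagonal α)) → Y) (ha' : Continuous a') (c : {w : InfinitePlace L // IsComplex w} → Fin 3 → ℝ) :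
    Continuous (descConj (gprimeTorus L α S' c) (chartTorusG L α S') (forall_mem_chartTorusG_comm L α S' c) a') := by
  rw [(QuotientGroup.isQuotientMap_mk _).continuous_iff, descConj_comp_mk]
  exact ha'.comp ((continuous_id.mul continuous_const).mul continuous_id.inv)

/-- **AT A REGULAR CHART POINT THE CHART TORUS IS THE CENTRALISER**: for `α i ≠ 0`, split places inside ★ `splitChartPlaces L α` and `c ∈ RegG S′`,
`T_{S′} = Z(gprimeTorus α S′ c)` — ★ (CENT-G) `mem_centralizer_gprimeTorus_iff` says the centraliser IS the range of the chart (hence closed), and the range is dense in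
`T_{S′}` by definition.  The junction's «`Z(γ′)` at a chart point is the chart torus, uniformly in `c`». [cite: Rogawski1990, §3.6 p. 31] [cite: Shelstad1979, §4 p. 22] -/
theorem chartTorusG_eq_centralizer (hα : ∀ i, α i ≠ 0) (hS' : ∀ w, w ∈ S' → w ∈ splitChartPlaces L α) {c : {w : InfinitePlace L // IsComplex w} → Fin 3 → ℝ} (hc : c ∈ ArchCartan.RegG S') :
    chartTorusG L α S' = Subgroup.centralizer ({gprimeTorus L α S' c} : Set ↥(arch (↥(maximalRealSubfield L)) L (IsCMField.complexConj L) 3 (Matrix.diagonal α))) := by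
  refine le_antisymm (chartTorusG_le_centralizer L α S' c) ?_
  intro g hg
  obtain ⟨c', rfl⟩ := (mem_centralizer_gprimeTorus_iff L α S' hα hS' hc g).mp hg
  exact gprimeTorus_mem_chartTorusG L α S' c'

/-- **The box image `B′_{S′} ⊆ T_{S′}`**: the image of the SAME closed coordinate box ★ `chartBox L S′` as on the `H` side (`x ∈ [0,1]` in the split slot, angles `∈ [0, 2π]`)
under the `G′`-chart — the compact set whose Haar mass normalises `chartOrbG` (PACK-SPEC (δ3)). [cite: Rogawski1990, §8.2 p. 122] [cite: Folland1995, §2.2] -/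
def chartBoxImgG : Set ↥(chartTorusG L α S') :=
  (fun c => (⟨gprimeTorus L α S' c, gprimeTorus_mem_chartTorusG L α S' c⟩ : ↥(chartTorusG L α S'))) '' chartBox L S'

/-- `B′_{S′}` is compact (continuous image of the compact box). [cite: Folland1995, §2.2] -/
theorem isCompact_chartBoxImgG : IsCompact (chartBoxImgG L α S') :=
  (isCompact_chartBox L S').image ((continuous_gprimeTorus L α S').subtype_mk _)

/-- `1 ∈ B′_{S′}` (the image of `c = 0`). [cite: Folland1995, §2.2] -/
theorem one_mem_chartBoxImgG : (1 : ↥(chartTorusG L α S')) ∈ chartBoxImgG L α S' :=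
  ⟨0, zero_mem_chartBox L S', Subtype.ext (gprimeTorus_zero L α S')⟩

end Torus

/-! ## §3 The Haar measure of the chart torus -/

section Haar

variable (L : Type) [Field L] [NumberField L] [IsCMField L] (α : Fin 3 → L) (S' : Finset {w : InfinitePlace L // IsComplex w})
  [MeasurableSpace ↥(arch (↥(maximalRealSubfield L)) L (IsCMField.complexConj L) 3 (Matrix.diagonal α))] [BorelSpace ↥(arch (↥(maximalRealSubfield L)) L (IsCMField.complexConj L) 3 (Matrix.diagonal α))]

/-- **THE (AUXILIARY) HAAR MEASURE `dt′_{S′}` OF THE CHART TORUS `T_{S′}`** — Mathlib's Haar measure of the locally compact abelian group `T_{S′}` at a fixed positive compact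
(Borel σ-algebra induced from `G′_∞`).  AUXILIARY: consumers read `chartOrbG`, which carries the prefactor `dt′(B′)` and is therefore independent of this choice (PACK-SPEC (δ3)).
[cite: Folland1995, §2.2; §2.6 (2.52)] [cite: Shelstad1979, §4 p. 22] -/
def chartHaarG : Measure ↥(chartTorusG L α S') :=
  haveI := locallyCompactSpace_chartTorusG L α S'
  haarMeasure (Classical.arbitrary (TopologicalSpace.PositiveCompacts ↥(chartTorusG L α S')))

/-- `dt′_{S′}` is a Haar measure. [cite: Folland1995, §2.2] -/
theorem isHaarMeasure_chartHaarG : (chartHaarG L α S').IsHaarMeasure := by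
  haveI := locallyCompactSpace_chartTorusG L α S'
  unfold chartHaarG
  infer_instance

/-- `dt′_{S′}` is regular. [cite: Folland1995, §2.2] -/
theorem regular_chartHaarG : (chartHaarG L α S').Regular := by
  haveI := locallyCompactSpace_chartTorusG L α S'
  unfold chartHaarG
  infer_instance

/-- `dt′_{S′}` is left invariant. [cite: Folland1995, §2.2] -/
theorem isMulLeftInvariant_chartHaarG : (chartHaarG L α S').IsMulLeftInvariant :=
  haveI := isHaarMeasure_chartHaarG L α S'
  inferInstance

/-- `dt′_{S′}` is finite on compact sets. [cite: Folland1995, §2.2] -/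
theorem isFiniteMeasureOnCompacts_chartHaarG : IsFiniteMeasureOnCompacts (chartHaarG L α S') :=
  haveI := isHaarMeasure_chartHaarG L α S'
  inferInstance

/-- `dt′_{S′}` is positive on open sets. [cite: Folland1995, §2.2] -/
theorem isOpenPosMeasure_chartHaarG : (chartHaarG L α S').IsOpenPosMeasure :=
  haveI := isHaarMeasure_chartHaarG L α S'
  inferInstance

/-- `dt′(B′) < ∞` (compact). [cite: Folland1995, §2.2] -/
theorem chartHaarG_chartBoxImgG_lt_top : chartHaarG L α S' (chartBoxImgG L α S') < ⊤ :=
  haveI := isHaarMeasure_chartHaarG L α S'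
  (isCompact_chartBoxImgG L α S').measure_lt_top

/-- **`dt′_{S′}` is inversion invariant** (`T_{S′}` is abelian; Mathlib `IsHaarMeasure.isInvInvariant_of_regular`) — the unimodularity binder of ★ `quotientMeasure`.
[cite: Folland1995, §2.2; §2.6 Thm. 2.49] -/
theorem isInvInvariant_chartHaarG : (chartHaarG L α S').IsInvInvariant := by
  haveI := locallyCompactSpace_chartTorusG L α S'
  haveI := isHaarMeasure_chartHaarG L α S'
  haveI := regular_chartHaarG L α S'
  letI : CommGroup ↥(chartTorusG L α S') := { (inferInstance : Group ↥(chartTorusG L α S')) with mul_comm := chartTorusG_mul_comm L α S' }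
  exact IsHaarMeasure.isInvInvariant_of_regular (chartHaarG L α S')

end Haar

/-! ## §4 The chart quotient measure and the chart orbital functional `chartOrbG` -/

section Orb

variable (L : Type) [Field L] [NumberField L] [IsCMField L] (α : Fin 3 → L)
  [MeasurableSpace ↥(arch (↥(maximalRealSubfield L)) L (IsCMField.complexConj L) 3 (Matrix.diagonal α))] [BorelSpace ↥(arch (↥(maximalRealSubfield L)) L (IsCMField.complexConj L) 3 (Matrix.diagonal α))]
  (ν' : Measure ↥(arch (↥(maximalRealSubfield L)) L (IsCMField.complexConj L) 3 (Matrix.diagonal α))) [IsFiniteMeasureOnCompacts ν'] [ν'.IsMulRightInvariant]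
  (S' : Finset {w : InfinitePlace L // IsComplex w})

/-- **THE CHART QUOTIENT MEASURE `dν′ ∕ dt′_{S′}` on `G′_∞ ⧸ T_{S′}`** (★ `quotientMeasure`, Deitmar–Echterhoff Thm. 1.5.3; the quotient carries its Borel σ-algebra).
[cite: DeitmarEchterhoff2014, Thm. 1.5.3] [cite: Folland1995, §2.6 Thm. 2.49] -/
def chartQuotientMeasureG : @Measure (↥(arch (↥(maximalRealSubfield L)) L (IsCMField.complexConj L) 3 (Matrix.diagonal α)) ⧸ chartTorusG L α S') (borel _) := by
  letI : MeasurableSpace (↥(arch (↥(maximalRealSubfield L)) L (IsCMField.complexConj L) 3 (Matrix.diagonal α)) ⧸ chartTorusG L α S') := borel _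
  haveI : BorelSpace (↥(arch (↥(maximalRealSubfield L)) L (IsCMField.complexConj L) 3 (Matrix.diagonal α)) ⧸ chartTorusG L α S') := ⟨rfl⟩
  haveI := isMulLeftInvariant_chartHaarG L α S'
  haveI := isFiniteMeasureOnCompacts_chartHaarG L α S'
  haveI := isOpenPosMeasure_chartHaarG L α S'
  haveI := isInvInvariant_chartHaarG L α S'
  exact quotientMeasure (chartTorusG L α S') (chartHaarG L α S') (isClosed_chartTorusG L α S') ν'

/-- **THE CHART ORBITAL FUNCTIONAL ON `G′`** `chartOrbG ν′ S′ a′ c := dt′(B′) · ∫_{G′_∞ ⧸ T_{S′}} a′ (y · gprimeTorus α S′ c · y⁻¹) d(dν′ ∕ dt′)(ȳ)` (★ `descConj`), defined at EVERY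
coordinate `c` (chart points commute with `T_{S′}`).  The prefactor `dt′(B′)` makes the functional INDEPENDENT of the auxiliary Haar measure (PACK-SPEC (δ3)); at regular `c` it is
the Weil-form ORDINARY orbital integral of `a′` at `gprimeTorus α S′ c` up to the (CUR) scalar (the frame's torus mass of the box).
[cite: Rogawski1990, §8.2 p. 122; §8.3 p. 124] [cite: Shelstad1979, §4 p. 22] [cite: DeitmarEchterhoff2014, Thm. 1.5.3] -/
def chartOrbG (a' : ↥(arch (↥(maximalRealSubfield L)) L (IsCMField.complexConj L) 3 (Matrix.diagonal α)) → ℂ) (c : {w : InfinitePlace L // IsComplex w} → Fin 3 → ℝ) : ℂ := by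
  letI : MeasurableSpace (↥(arch (↥(maximalRealSubfield L)) L (IsCMField.complexConj L) 3 (Matrix.diagonal α)) ⧸ chartTorusG L α S') := borel _
  exact ((chartHaarG L α S' (chartBoxImgG L α S')).toReal : ℂ) *
    ∫ y, descConj (gprimeTorus L α S' c) (chartTorusG L α S') (forall_mem_chartTorusG_comm L α S' c) a' y ∂(chartQuotientMeasureG L α ν' S')

/-- `chartOrbG` unfolded (definitional). [cite: Rogawski1990, §8.2 p. 122] -/
theorem chartOrbG_def (a' : ↥(arch (↥(maximalRealSubfield L)) L (IsCMField.complexConj L) 3 (Matrix.diagonal α)) → ℂ) (c : {w : InfinitePlace L // IsComplex w} → Fin 3 → ℝ) :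
    chartOrbG L α ν' S' a' c =
      (letI : MeasurableSpace (↥(arch (↥(maximalRealSubfield L)) L (IsCMField.complexConj L) 3 (Matrix.diagonal α)) ⧸ chartTorusG L α S') := borel _
       ((chartHaarG L α S' (chartBoxImgG L α S')).toReal : ℂ) *
         ∫ y, descConj (gprimeTorus L α S' c) (chartTorusG L α S') (forall_mem_chartTorusG_comm L α S' c) a' y ∂(chartQuotientMeasureG L α ν' S')) := rfl

/-- **`chartOrbG` depends on `c` only through the chart point `gprimeTorus α S′ c`** (so the `2π`-periods of the angle slots fix it: (P) of the D2′-pack is one line over this).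
[cite: Rogawski1990, §8.2 p. 122] -/
theorem chartOrbG_congr (a' : ↥(arch (↥(maximalRealSubfield L)) L (IsCMField.complexConj L) 3 (Matrix.diagonal α)) → ℂ) {c c' : {w : InfinitePlace L // IsComplex w} → Fin 3 → ℝ} (h : gprimeTorus L α S' c = gprimeTorus L α S' c') :
    chartOrbG L α ν' S' a' c = chartOrbG L α ν' S' a' c' := by
  rw [chartOrbG_def, chartOrbG_def]
  have hint : descConj (gprimeTorus L α S' c) (chartTorusG L α S') (forall_mem_chartTorusG_comm L α S' c) a' =
      descConj (gprimeTorus L α S' c') (chartTorusG L α S') (forall_mem_chartTorusG_comm L α S' c') a' := by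
    funext y
    induction y using QuotientGroup.induction_on with
    | H g => rw [descConj_mk, descConj_mk, h]
  rw [hint]

/-- `chartOrbG ν′ S′ 0 c = 0`. [cite: Rogawski1990, §8.2 p. 122] -/
theorem chartOrbG_zero (c : {w : InfinitePlace L // IsComplex w} → Fin 3 → ℝ) : chartOrbG L α ν' S' 0 c = 0 := by
  rw [chartOrbG_def]
  have h : descConj (gprimeTorus L α S' c) (chartTorusG L α S') (forall_mem_chartTorusG_comm L α S' c) (0 : ↥(arch (↥(maximalRealSubfield L)) L (IsCMField.complexConj L) 3 (Matrix.diagonal α)) → ℂ) = 0 := by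
    funext y
    induction y using QuotientGroup.induction_on
    rfl
  rw [h]
  simp only [Pi.zero_apply, integral_zero, mul_zero]

end Orb

end Literature.NumberTheory.Automorphic.UnitaryGroup

end
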